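import Summits.QuantumFields.YangMills.Theorems.FluctuationComparisonRegPrIntLS2BetaLaplaceInst
import HarnessLib

/-!
# S2β · LAPLACE row — LIMIT-INST, LOCAL-TRANSVERSAL EDITION (seam (a) of the v8 docking memo; pen w5-20520 g14)

Cell `ym3-torus` (rung R3: continuum `SU(2)` Yang–Mills on `T³` — NOT `d = 4`, NOT infinite volume, NOT a mass gap, NOT Clay); width seat `ym-ust-20520-w5` g14;
helper of the crux `stmt-QuantumFields-20520` (`--supports`, NOT a proof of it).  THEOREMS ONLY (0 `def`, 0 `sorry`; default heartbeats).

WHAT.  ✓`…S2BetaLaplaceInst.laplaceLimit_of_charts(_tendsto)` (w5-20520 g13) reads the (C3β″) transversal `σ : ℝ^{dV} → SU(2)^{bonds_K}` through the GLOBAL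
row `hσX : ∀ y, σ y ∈ Xc` (the transversal never leaves CHART∞'s compact carrier `Xc`).  The tube of record (px21 g9 ✓`…S2BetaTubularChartDock.
exists_tubularHaarChart_pivotAct`, smooth edition ✓`…S2BetaTubularChartActSmooth`) is a global exponential transversal, and `Xc = {z | c.jac (V,z) ≠ 0}`
(w3-20520 g14, CHART∞ V-c2) is compact: the global row is false for that pair, while every use the door makes of `σ` away from `0` is bookkeeping.  THIS FILE
proves the same two theorems with the single binder change

  `(hσX : ∀ y, σ y ∈ Xc)`  ↦  `(hσX : ∀ᶠ y in 𝓝 0, σ y ∈ Xc)`,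

every other binder and both conclusions token-identical (so the DECAY door's named constant `(2π)^{dV∕2}·ν(Kg)·(∫_{ball ρ}Jd(z,0)dz ∕ ν((e(ball ρ)·Sst)⁻¹))·
jac_V(σ 0) ∕ √det Ah ∕ β_K^{dV∕2}` is unchanged).  PROOF = the radial clamp, done once inside the door: with `closedBall 0 r ⊆ σ⁻¹' Xc`, the retraction
`π y := (r ∕ max r ‖y‖) • y` is continuous, the identity on `closedBall 0 r` and lands in it; `σ̃ := σ ∘ π` satisfies the global row, agrees with `σ` near `0`
(so the filter row `hΘ'𝓝` and the Peano row `hS2` transfer by eventual equality and `σ̃ 0 = σ 0` carries `hstab hO0 hmin ha0 hgpos` and the conclusion),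
`hfix` survives because it is pointwise in `σ y`, and the Haar-chart rows restrict to the shrunk window `W̃ := W ∩ {p | p.2 ∈ ball 0 r}` on which the tube maps
agree: the chart identity `μ_K⌊(Θ '' W̃) = Θ_*((vol ⊗ vol)⌊W̃ · Jd)` follows from the `W`-identity by `Measure.restrict_map` + `restrict_withDensity` +
`Θ⁻¹'(Θ '' W̃) ∩ W = W̃` (injectivity on `W`), the Lusin–Souslin measurability of `Θ '' W̃`, and `Measure.map_congr`.

HONEST SCOPE.  A door-side adapter (general topology + measure restriction); every analytic input stays a displayed hypothesis supplied by the named pens; nothing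
of CHART∞ ∕ (C3) ∕ DECAY ∕ LAPLACE ∕ S2β ∕ the crux 20520 is proved here; `YM3TorusSU2` NOT proved; the Yang–Mills mass gap (Clay) NOT proved.

References: [Balaban1985UV3] CMP 102 (1985) (2) p. 256, (41) p. 266; [Balaban1985Variational] CMP 102 (1985) Thm 1 (8)–(10) p. 279;
[HasenpflugRudolfSprungk2024] Ann. Appl. Probab. 34 (2024) §3.1, §3.4; [Breitung1994] LNM 1592 Thm 41 p. 56; [Kechris1995] Thm 15.1 (Lusin–Souslin).
-/

noncomputable section

open MeasureTheory MeasureTheory.Measure Filter Topology Set Module Metric Function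
open scoped Real InnerProductSpace ENNReal NNReal Pointwise
open Literature.MathematicalPhysics.QuantumFieldTheory.Balaban1983to89
open Literature.MathematicalPhysics.QuantumFieldTheory.Balaban1983to89.T3ContinuumYM3Torus
open Literature.MathematicalPhysics.QuantumFieldTheory.Balaban1983to89.T3UnitLawDensityEML
open scoped Literature.MathematicalPhysics.QuantumFieldTheory.Balaban1983to89.T3OrbitAverage
open Summit.QuantumFields.YangMills.Theorems.FluctuationComparisonRegPrIntLWregGlue
open Summit.QuantumFields.YangMills.Theorems.FluctuationComparisonRegPrIntLS2BetaLaplaceInst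

namespace Summit.QuantumFields.YangMills.Theorems.FluctuationComparisonRegPrIntLS2BetaLaplaceInstLocal

/-! ## §1 The radial clamp (general topology on a real normed space) -/

/-- **RADIAL CLAMP.**  On a real normed space, for `r > 0` the map `π y := (r ∕ max r ‖y‖) • y` is continuous, fixes `0`, is the identity on the closed ball
of radius `r` (hence agrees with the identity near `0`), and takes values in that ball. [folklore] -/
theorem radialClamp_props {E : Type*} [NormedAddCommGroup E] [NormedSpace ℝ E] {r : ℝ} (hr : 0 < r) :
    Continuous (fun y : E => (r / max r ‖y‖) • y) ∧ (r / max r ‖(0 : E)‖) • (0 : E) = 0 ∧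
      (∀ y : E, y ∈ closedBall (0 : E) r → (r / max r ‖y‖) • y = y) ∧
      (∀ᶠ y in 𝓝 (0 : E), (r / max r ‖y‖) • y = y) ∧ (∀ y : E, (r / max r ‖y‖) • y ∈ closedBall (0 : E) r) := by
  have hM : ∀ y : E, 0 < max r ‖y‖ := fun y => lt_of_lt_of_le hr (le_max_left _ _)
  have hid : ∀ y : E, y ∈ closedBall (0 : E) r → (r / max r ‖y‖) • y = y := by
    intro y hy
    rw [mem_closedBall_zero_iff] at hy
    rw [max_eq_left hy, div_self hr.ne', one_smul]
  refine ⟨?_, smul_zero _, hid, Filter.eventually_of_mem (closedBall_mem_nhds (0 : E) hr) hid, fun y => ?_⟩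
  · exact ((continuous_const.max continuous_norm).inv₀ (fun y => (hM y).ne') |>.const_smul r |>.smul continuous_id).congr
      fun y => by simp [div_eq_mul_inv, smul_eq_mul]
  · rw [mem_closedBall_zero_iff, norm_smul, Real.norm_eq_abs, abs_of_pos (div_pos hr (hM y))]
    calc r / max r ‖y‖ * ‖y‖ ≤ r / max r ‖y‖ * max r ‖y‖ := mul_le_mul_of_nonneg_left (le_max_right _ _) (div_pos hr (hM y)).le
      _ = r := div_mul_cancel₀ r (hM y).ne'

/-! ## §2 The chart identity restricts to a measurable sub-window on which two tube maps agree -/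

/-- **RESTRICTING A HAAR-CHART IDENTITY.**  If `μ⌊(Θ '' W) = Θ_*((λ⌊W)·D)` for a measurable `Θ` injective on the measurable window `W`, if `W' ⊆ W` is
measurable with `Θ '' W'` measurable, and if `Θ'` agrees with `Θ` on `W'`, then `μ⌊(Θ' '' W') = Θ'_*((λ⌊W')·D)`. [folklore] -/
theorem restrict_chart_identity {X Y : Type*} [MeasurableSpace X] [MeasurableSpace Y] {μ : Measure Y} {lam : Measure X}
    {D : X → ℝ≥0∞} {Θ Θ' : X → Y} (hΘ : Measurable Θ) {W W' : Set X} (hinj : InjOn Θ W) (hW'W : W' ⊆ W) (hW' : MeasurableSet W')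
    (hTW' : MeasurableSet (Θ '' W')) (heq : EqOn Θ' Θ W')
    (hchart : μ.restrict (Θ '' W) = ((lam.restrict W).withDensity D).map Θ) :
    μ.restrict (Θ' '' W') = ((lam.restrict W').withDensity D).map Θ' := by
  -- the two tube maps have the same image of `W'` and agree a.e. for the restricted weighted measure
  have himg : Θ' '' W' = Θ '' W' := heq.image_eq
  have hae : Θ' =ᵐ[(lam.restrict W').withDensity D] Θ :=
    (withDensity_absolutelyContinuous _ _).ae_le ((ae_restrict_mem hW').mono fun w hw => heq hw)
  rw [himg, Measure.map_congr hae]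
  -- restrict the `W`-identity to `Θ '' W'`
  have hsub : Θ '' W' ⊆ Θ '' W := image_mono hW'W
  have hpre : Θ ⁻¹' (Θ '' W') ∩ W = W' := hinj.preimage_image_inter hW'W
  calc μ.restrict (Θ '' W') = (μ.restrict (Θ '' W)).restrict (Θ '' W') := by
        rw [restrict_restrict hTW', inter_eq_left.mpr hsub]
    _ = (((lam.restrict W).withDensity D).map Θ).restrict (Θ '' W') := by rw [hchart]
    _ = (((lam.restrict W).withDensity D).restrict (Θ ⁻¹' (Θ '' W'))).map Θ := Measure.restrict_map hΘ hTW'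
    _ = ((lam.restrict W').withDensity D).map Θ := by
        rw [restrict_withDensity (hTW'.preimage hΘ), restrict_restrict (hTW'.preimage hΘ), hpre]

/-! ## §3 LIMIT-INST with the LOCAL transversal row -/

/-- ★★★ **LIMIT-INST, EXPLICIT EDITION, LOCAL-TRANSVERSAL ROW** — ✓`…S2BetaLaplaceInst.laplaceLimit_of_charts_tendsto` VERBATIM except that the (C3β″) row
`hσX : ∀ y, σ y ∈ Xc` is replaced by its germ at `0`, `hσX : ∀ᶠ y in 𝓝 0, σ y ∈ Xc` (the transversal meets CHART∞'s carrier NEAR the minimiser); same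
conclusion, same named constant.  Proof: the radial clamp `σ̃ := σ ∘ π` (§1) satisfies the global row, agrees with `σ` near `0`, and the Haar-chart rows restrict
to `W ∩ {p | p.2 ∈ ball 0 r}` (§2); then the global edition applies to `σ̃`.
[cite: Balaban1985UV3, (2) p. 256 and (41) p. 266] [cite: Balaban1985Variational, Thm 1 (8)-(10) p. 279] [cite: Breitung1994, Thm 41 p. 56]
[cite: HasenpflugRudolfSprungk2024, §3.1 Assumption 3 (M)(T) and §3.4] -/
theorem laplaceLimit_of_charts_tendsto_local
    (F : T3Family) {γ : ℝ} (hγ : 0 < γ) {J K : ℕ} (hJK : J ≤ K)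
    {Sf : Set (GaugeField (F.P K) 0 (Matrix.specialUnitaryGroup (Fin 2) ℂ))} (hSf : MeasurableSet Sf)
    {O : Set (GaugeField (F.P J) 0 (Matrix.specialUnitaryGroup (Fin 2) ℂ))} (hO : IsOpen O)
    (c : WindowChart F hJK Sf O) {V : GaugeField (F.P J) 0 (Matrix.specialUnitaryGroup (Fin 2) ℂ)} (hV : V ∈ O) (m : ℝ)
    -- the group of record: a compact subgroup `S` (the residual gauge group) × the pivot translations, with a Haar measure
    (S : Subgroup (Site (F.P K) 0 → Matrix.specialUnitaryGroup (Fin 2) ℂ)) (hS : CompactSpace S)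
    (ν : Measure (S × (PBond (F.P K) (K - J) → Matrix.specialUnitaryGroup (Fin 2) ℂ))) [ν.IsHaarMeasure]
    -- the action of `Kg` on the fine fields (of record: px11's pivot-blind `pivotAct F hJK (iterCentralBond (K−J))`; only its four rows are used)
    (act : S × (PBond (F.P K) (K - J) → Matrix.specialUnitaryGroup (Fin 2) ℂ) →
      GaugeField (F.P K) 0 (Matrix.specialUnitaryGroup (Fin 2) ℂ) → GaugeField (F.P K) 0 (Matrix.specialUnitaryGroup (Fin 2) ℂ))
    (hact : Continuous fun p : (S × (PBond (F.P K) (K - J) → Matrix.specialUnitaryGroup (Fin 2) ℂ)) ×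
      GaugeField (F.P K) 0 (Matrix.specialUnitaryGroup (Fin 2) ℂ) => act p.1 p.2)
    (hmul : ∀ k k' z, act (k * k') z = act k (act k' z)) (hone : ∀ z, act 1 z = z)
    (hpres : ∀ k, MeasurePreserving (act k) (fieldMeasure (F.P K) 0 (Matrix.specialUnitaryGroup (Fin 2) ℂ))
      (fieldMeasure (F.P K) 0 (Matrix.specialUnitaryGroup (Fin 2) ℂ)))
    -- CHART∞ rows at `V` (w3-20520): the compact invariant pivot-blind set carrying continuity, vanishing off it, invariances, relative openness
    {Xc : Set (GaugeField (F.P K) 0 (Matrix.specialUnitaryGroup (Fin 2) ℂ))} (hXc : IsCompact Xc) (hXinv : ∀ k z, z ∈ Xc → act k z ∈ Xc)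
    (hvan : ∀ z, z ∉ Xc → (c.jac (V, z) : ℝ) = 0)
    (hA : ContinuousOn (fun z => wilsonAction4 (c.Φ (V, z))) Xc) (ha : ContinuousOn (fun z => (c.jac (V, z) : ℝ)) Xc)
    (hAinv : ∀ k, ∀ z ∈ Xc, wilsonAction4 (c.Φ (V, act k z)) = wilsonAction4 (c.Φ (V, z)))
    (hainv : ∀ k, ∀ z ∈ Xc, (c.jac (V, act k z) : ℝ) = c.jac (V, z))
    (hOrel : IsOpen ((Subtype.val : Xc → GaugeField (F.P K) 0 (Matrix.specialUnitaryGroup (Fin 2) ℂ)) ⁻¹' {z | c.Φ (V, z) ∈ Sf}))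
    (hOinv : ∀ k, ∀ z ∈ Xc, c.Φ (V, z) ∈ Sf → c.Φ (V, act k z) ∈ Sf)
    -- (C3β″) rows (px21): tubular Haar coordinates around the `act`-orbit of the minimiser, the transversal meeting `Xc` NEAR `0`, the slice
    {dZ dV : ℕ} (e : EuclideanSpace ℝ (Fin dZ) → S × (PBond (F.P K) (K - J) → Matrix.specialUnitaryGroup (Fin 2) ℂ))
    (σ : EuclideanSpace ℝ (Fin dV) → GaugeField (F.P K) 0 (Matrix.specialUnitaryGroup (Fin 2) ℂ))
    (he : Continuous e) (he1 : e 0 = 1) (he𝓝 : 𝓝 (1 : S × (PBond (F.P K) (K - J) → Matrix.specialUnitaryGroup (Fin 2) ℂ)) ≤ map e (𝓝 0))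
    (hσ : Continuous σ) (hσX : ∀ᶠ y in 𝓝 0, σ y ∈ Xc)
    (hΘ'𝓝 : 𝓝 (σ 0) ≤ map (fun p : EuclideanSpace ℝ (Fin dZ) × EuclideanSpace ℝ (Fin dV) => act (e p.1) (σ p.2)) (𝓝 0))
    {W : Set (EuclideanSpace ℝ (Fin dZ) × EuclideanSpace ℝ (Fin dV))} (hWo : IsOpen W)
    (hinj : InjOn (fun p : EuclideanSpace ℝ (Fin dZ) × EuclideanSpace ℝ (Fin dV) => act (e p.1) (σ p.2)) W)
    {Jd : EuclideanSpace ℝ (Fin dZ) × EuclideanSpace ℝ (Fin dV) → ℝ} (hJc : ContinuousOn Jd W) (hJ0 : ∀ w ∈ W, 0 ≤ Jd w)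
    (hchart : (fieldMeasure (F.P K) 0 (Matrix.specialUnitaryGroup (Fin 2) ℂ)).restrict
        ((fun p : EuclideanSpace ℝ (Fin dZ) × EuclideanSpace ℝ (Fin dV) => act (e p.1) (σ p.2)) '' W) =
      ((((volume : Measure (EuclideanSpace ℝ (Fin dZ))).prod (volume : Measure (EuclideanSpace ℝ (Fin dV)))).restrict W).withDensity
          fun w => ENNReal.ofReal (Jd w)).map (fun p : EuclideanSpace ℝ (Fin dZ) × EuclideanSpace ℝ (Fin dV) => act (e p.1) (σ p.2)))
    {ρ : ℝ} (hρ : 0 < ρ) (hρW : closedBall (0 : EuclideanSpace ℝ (Fin dZ)) ρ ×ˢ {(0 : EuclideanSpace ℝ (Fin dV))} ⊆ W)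
    {Sst : Set (S × (PBond (F.P K) (K - J) → Matrix.specialUnitaryGroup (Fin 2) ℂ))}
    (hstab : ∀ k, act k (σ 0) = σ 0 → k ∈ Sst) (hfix : ∀ s ∈ Sst, ∀ y, act s (σ y) = σ y)
    -- EXW rows at `V`: the base point of the transversal is charted into the event and minimises with value `m`
    (hO0 : c.Φ (V, σ 0) ∈ Sf) (hmin : wilsonAction4 (c.Φ (V, σ 0)) = m)
    -- GAP♯ rows at `V`: growth to the orbit on the event
    {g : GaugeField (F.P K) 0 (Matrix.specialUnitaryGroup (Fin 2) ℂ) → ℝ} (hg : ContinuousOn g Xc) (hg0 : ∀ z ∈ Xc, 0 ≤ g z)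
    (hgpos : ∀ z ∈ Xc, (∀ k, act k (σ 0) ≠ z) → 0 < g z)
    (hgrow : ∀ z ∈ Xc, c.Φ (V, z) ∈ Sf → m + g z ≤ wilsonAction4 (c.Φ (V, z)))
    -- the Peano row (transversal Hessian; seam GAP 2)
    {Ah : EuclideanSpace ℝ (Fin dV) →ₗ[ℝ] EuclideanSpace ℝ (Fin dV)} (hAs : Ah.IsSymmetric) (hpos : ∀ y, y ≠ 0 → 0 < ⟪Ah y, y⟫_ℝ)
    (hS2 : (fun y => wilsonAction4 (c.Φ (V, σ y)) - wilsonAction4 (c.Φ (V, σ 0)) - (1 / 2) * ⟪Ah y, y⟫_ℝ) =o[𝓝 0] fun y => ‖y‖ ^ 2) :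
    Tendsto (fun lam : ℝ => lam ^ ((dV : ℝ) / 2) *
        (heightDensityCan F (γ / lam) hJK Sf V * Real.exp (lam * (F.scheme ℰp γ).β K * m))) atTop
      (𝓝 (((2 * π) ^ ((dV : ℝ) / 2) * (ν.real univ *
          ((∫ z in ball (0 : EuclideanSpace ℝ (Fin dZ)) ρ, Jd (z, 0)) /
              (ν (((e '' ball (0 : EuclideanSpace ℝ (Fin dZ)) ρ) * Sst)⁻¹)).toReal * (c.jac (V, σ 0) : ℝ) /
            Real.sqrt (LinearMap.det Ah)))) / ((F.scheme ℰp γ).β K) ^ ((dV : ℝ) / 2))) := by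
  classical
  -- a closed ball on which the transversal stays in the carrier
  obtain ⟨δ, hδ, hδX⟩ := Metric.eventually_nhds_iff_ball.mp hσX
  set r : ℝ := δ / 2 with hr_def
  have hr : 0 < r := by positivity
  have hrX : ∀ y ∈ closedBall (0 : EuclideanSpace ℝ (Fin dV)) r, σ y ∈ Xc :=
    fun y hy => hδX y (closedBall_subset_ball (by rw [hr_def]; linarith) hy)
  -- the radial clamp and the clamped transversal
  obtain ⟨hπc, hπ0, hπid, hπnhds, hπr⟩ := radialClamp_props (E := EuclideanSpace ℝ (Fin dV)) hr
  obtain ⟨σ', hσ'⟩ : ∃ σ' : EuclideanSpace ℝ (Fin dV) → GaugeField (F.P K) 0 (Matrix.specialUnitaryGroup (Fin 2) ℂ),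
      σ' = fun y => σ ((r / max r ‖y‖) • y) := ⟨_, rfl⟩
  have hσ'c : Continuous σ' := by rw [hσ']; exact hσ.comp hπc
  have hσ'0 : σ' 0 = σ 0 := by rw [hσ']; exact congrArg σ hπ0
  have hσ'eq : ∀ᶠ y in 𝓝 (0 : EuclideanSpace ℝ (Fin dV)), σ' y = σ y :=
    hπnhds.mono fun y hy => by rw [hσ']; exact congrArg σ hy
  have hσ'ball : ∀ y ∈ ball (0 : EuclideanSpace ℝ (Fin dV)) r, σ' y = σ y :=
    fun y hy => by rw [hσ']; exact congrArg σ (hπid y (ball_subset_closedBall hy))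
  have hσ'X : ∀ y, σ' y ∈ Xc := fun y => by rw [hσ']; exact hrX _ (hπr y)
  -- the tube maps and the shrunk window
  set Θ : EuclideanSpace ℝ (Fin dZ) × EuclideanSpace ℝ (Fin dV) → GaugeField (F.P K) 0 (Matrix.specialUnitaryGroup (Fin 2) ℂ) :=
    fun p => act (e p.1) (σ p.2) with hΘ
  set Θ' : EuclideanSpace ℝ (Fin dZ) × EuclideanSpace ℝ (Fin dV) → GaugeField (F.P K) 0 (Matrix.specialUnitaryGroup (Fin 2) ℂ) :=
    fun p => act (e p.1) (σ' p.2) with hΘ'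
  set W' : Set (EuclideanSpace ℝ (Fin dZ) × EuclideanSpace ℝ (Fin dV)) := W ∩ {p | p.2 ∈ ball (0 : EuclideanSpace ℝ (Fin dV)) r} with hW'
  have hΘc : Continuous Θ := hact.comp (he.prodMap hσ)
  have hΘm : Measurable Θ := hΘc.measurable
  have hW'o : IsOpen W' := hWo.inter (isOpen_ball.preimage continuous_snd)
  have hW'W : W' ⊆ W := inter_subset_left
  have heqOn : EqOn Θ' Θ W' := fun p hp => by
    simp only [hΘ, hΘ']; rw [hσ'ball p.2 hp.2]
  have hTW' : MeasurableSet (Θ '' W') := hW'o.measurableSet.image_of_continuousOn_injOn hΘc.continuousOn (hinj.mono hW'W)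
  -- the rows for the clamped transversal
  have hΘ'𝓝' : 𝓝 (σ' 0) ≤ map Θ' (𝓝 0) := by
    have hev : Θ' =ᶠ[𝓝 (0 : EuclideanSpace ℝ (Fin dZ) × EuclideanSpace ℝ (Fin dV))] Θ := by
      have hn : {p : EuclideanSpace ℝ (Fin dZ) × EuclideanSpace ℝ (Fin dV) | p.2 ∈ ball (0 : EuclideanSpace ℝ (Fin dV)) r} ∈
          𝓝 (0 : EuclideanSpace ℝ (Fin dZ) × EuclideanSpace ℝ (Fin dV)) :=
        (isOpen_ball.preimage continuous_snd).mem_nhds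
          (show (0 : EuclideanSpace ℝ (Fin dZ) × EuclideanSpace ℝ (Fin dV)).2 ∈ ball (0 : EuclideanSpace ℝ (Fin dV)) r from mem_ball_self hr)
      exact Filter.eventually_of_mem hn fun p hp => by simp only [hΘ, hΘ']; rw [hσ'ball p.2 hp]
    rw [hσ'0, Filter.map_congr hev]; exact hΘ'𝓝
  have hinj' : InjOn Θ' W' := fun p hp q hq hpq => hinj (hW'W hp) (hW'W hq) (by rwa [heqOn hp, heqOn hq] at hpq)
  have hchart' : (fieldMeasure (F.P K) 0 (Matrix.specialUnitaryGroup (Fin 2) ℂ)).restrict (Θ' '' W') =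
      ((((volume : Measure (EuclideanSpace ℝ (Fin dZ))).prod (volume : Measure (EuclideanSpace ℝ (Fin dV)))).restrict W').withDensity
          fun w => ENNReal.ofReal (Jd w)).map Θ' :=
    restrict_chart_identity hΘm hinj hW'W hW'o.measurableSet hTW' heqOn hchart
  have hρW' : closedBall (0 : EuclideanSpace ℝ (Fin dZ)) ρ ×ˢ {(0 : EuclideanSpace ℝ (Fin dV))} ⊆ W' := by
    intro p hp
    refine ⟨hρW hp, ?_⟩
    have h2 : p.2 = 0 := (mem_prod.mp hp).2
    show p.2 ∈ ball (0 : EuclideanSpace ℝ (Fin dV)) r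
    rw [h2]; exact mem_ball_self hr
  have hfix' : ∀ s ∈ Sst, ∀ y, act s (σ' y) = σ' y := fun s hs y => by rw [hσ']; exact hfix s hs _
  have hS2' : (fun y => wilsonAction4 (c.Φ (V, σ' y)) - wilsonAction4 (c.Φ (V, σ' 0)) - (1 / 2) * ⟪Ah y, y⟫_ℝ) =o[𝓝 0]
      fun y => ‖y‖ ^ 2 :=
    hS2.congr' (hσ'eq.mono fun y hy => by simp only [hy, hσ'0]) EventuallyEq.rfl
  have hstab' : ∀ k, act k (σ' 0) = σ' 0 → k ∈ Sst := by rw [hσ'0]; exact hstab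
  have hO0' : c.Φ (V, σ' 0) ∈ Sf := by rw [hσ'0]; exact hO0
  have hmin' : wilsonAction4 (c.Φ (V, σ' 0)) = m := by rw [hσ'0]; exact hmin
  have hgpos' : ∀ z ∈ Xc, (∀ k, act k (σ' 0) ≠ z) → 0 < g z := by rw [hσ'0]; exact hgpos
  -- the global edition for the clamped transversal
  have key := laplaceLimit_of_charts_tendsto F hγ hJK hSf hO c hV m S hS ν act hact hmul hone hpres hXc hXinv hvan hA ha hAinv hainv hOrel hOinv
    e σ' he he1 he𝓝 hσ'c hσ'X hΘ'𝓝' hW'o hinj' (hJc.mono hW'W) (fun w hw => hJ0 w (hW'W hw)) hchart' hρ hρW'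
    hstab' hfix' hO0' hmin' hg hg0 hgpos' hgrow hAs hpos hS2'
  rw [hσ'0] at key
  exact key

/-- ★ **LIMIT-INST, EXISTENTIAL EDITION, LOCAL-TRANSVERSAL ROW** — ✓`…S2BetaLaplaceInst.laplaceLimit_of_charts` VERBATIM except `hσX : ∀ᶠ y in 𝓝 0, σ y ∈ Xc`:
the KNIT's per-corner hypothesis `∃ ℓ > 0, λ^{dV∕2}·(heightDensityCan F (γ∕λ) hJK Sf V · e^{λ β_K m}) → ℓ`.
[cite: Balaban1985UV3, (2) p. 256 and (41) p. 266] [cite: Balaban1985Variational, Thm 1 (8)-(10) p. 279] [cite: Breitung1994, Thm 41 p. 56] -/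
theorem laplaceLimit_of_charts_local
    (F : T3Family) {γ : ℝ} (hγ : 0 < γ) {J K : ℕ} (hJK : J ≤ K)
    {Sf : Set (GaugeField (F.P K) 0 (Matrix.specialUnitaryGroup (Fin 2) ℂ))} (hSf : MeasurableSet Sf)
    {O : Set (GaugeField (F.P J) 0 (Matrix.specialUnitaryGroup (Fin 2) ℂ))} (hO : IsOpen O)
    (c : WindowChart F hJK Sf O) {V : GaugeField (F.P J) 0 (Matrix.specialUnitaryGroup (Fin 2) ℂ)} (hV : V ∈ O) (m : ℝ)
    (S : Subgroup (Site (F.P K) 0 → Matrix.specialUnitaryGroup (Fin 2) ℂ)) (hS : CompactSpace S)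
    (ν : Measure (S × (PBond (F.P K) (K - J) → Matrix.specialUnitaryGroup (Fin 2) ℂ))) [ν.IsHaarMeasure]
    (act : S × (PBond (F.P K) (K - J) → Matrix.specialUnitaryGroup (Fin 2) ℂ) →
      GaugeField (F.P K) 0 (Matrix.specialUnitaryGroup (Fin 2) ℂ) → GaugeField (F.P K) 0 (Matrix.specialUnitaryGroup (Fin 2) ℂ))
    (hact : Continuous fun p : (S × (PBond (F.P K) (K - J) → Matrix.specialUnitaryGroup (Fin 2) ℂ)) ×
      GaugeField (F.P K) 0 (Matrix.specialUnitaryGroup (Fin 2) ℂ) => act p.1 p.2)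
    (hmul : ∀ k k' z, act (k * k') z = act k (act k' z)) (hone : ∀ z, act 1 z = z)
    (hpres : ∀ k, MeasurePreserving (act k) (fieldMeasure (F.P K) 0 (Matrix.specialUnitaryGroup (Fin 2) ℂ))
      (fieldMeasure (F.P K) 0 (Matrix.specialUnitaryGroup (Fin 2) ℂ)))
    {Xc : Set (GaugeField (F.P K) 0 (Matrix.specialUnitaryGroup (Fin 2) ℂ))} (hXc : IsCompact Xc) (hXinv : ∀ k z, z ∈ Xc → act k z ∈ Xc)
    (hvan : ∀ z, z ∉ Xc → (c.jac (V, z) : ℝ) = 0)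
    (hA : ContinuousOn (fun z => wilsonAction4 (c.Φ (V, z))) Xc) (ha : ContinuousOn (fun z => (c.jac (V, z) : ℝ)) Xc)
    (hAinv : ∀ k, ∀ z ∈ Xc, wilsonAction4 (c.Φ (V, act k z)) = wilsonAction4 (c.Φ (V, z)))
    (hainv : ∀ k, ∀ z ∈ Xc, (c.jac (V, act k z) : ℝ) = c.jac (V, z))
    (hOrel : IsOpen ((Subtype.val : Xc → GaugeField (F.P K) 0 (Matrix.specialUnitaryGroup (Fin 2) ℂ)) ⁻¹' {z | c.Φ (V, z) ∈ Sf}))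
    (hOinv : ∀ k, ∀ z ∈ Xc, c.Φ (V, z) ∈ Sf → c.Φ (V, act k z) ∈ Sf)
    {dZ dV : ℕ} (e : EuclideanSpace ℝ (Fin dZ) → S × (PBond (F.P K) (K - J) → Matrix.specialUnitaryGroup (Fin 2) ℂ))
    (σ : EuclideanSpace ℝ (Fin dV) → GaugeField (F.P K) 0 (Matrix.specialUnitaryGroup (Fin 2) ℂ))
    (he : Continuous e) (he1 : e 0 = 1) (he𝓝 : 𝓝 (1 : S × (PBond (F.P K) (K - J) → Matrix.specialUnitaryGroup (Fin 2) ℂ)) ≤ map e (𝓝 0))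
    (hσ : Continuous σ) (hσX : ∀ᶠ y in 𝓝 0, σ y ∈ Xc)
    (hΘ'𝓝 : 𝓝 (σ 0) ≤ map (fun p : EuclideanSpace ℝ (Fin dZ) × EuclideanSpace ℝ (Fin dV) => act (e p.1) (σ p.2)) (𝓝 0))
    {W : Set (EuclideanSpace ℝ (Fin dZ) × EuclideanSpace ℝ (Fin dV))} (hWo : IsOpen W)
    (hinj : InjOn (fun p : EuclideanSpace ℝ (Fin dZ) × EuclideanSpace ℝ (Fin dV) => act (e p.1) (σ p.2)) W)
    {Jd : EuclideanSpace ℝ (Fin dZ) × EuclideanSpace ℝ (Fin dV) → ℝ} (hJc : ContinuousOn Jd W) (hJ0 : ∀ w ∈ W, 0 ≤ Jd w)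
    (hchart : (fieldMeasure (F.P K) 0 (Matrix.specialUnitaryGroup (Fin 2) ℂ)).restrict
        ((fun p : EuclideanSpace ℝ (Fin dZ) × EuclideanSpace ℝ (Fin dV) => act (e p.1) (σ p.2)) '' W) =
      ((((volume : Measure (EuclideanSpace ℝ (Fin dZ))).prod (volume : Measure (EuclideanSpace ℝ (Fin dV)))).restrict W).withDensity
          fun w => ENNReal.ofReal (Jd w)).map (fun p : EuclideanSpace ℝ (Fin dZ) × EuclideanSpace ℝ (Fin dV) => act (e p.1) (σ p.2)))
    {ρ : ℝ} (hρ : 0 < ρ) (hρW : closedBall (0 : EuclideanSpace ℝ (Fin dZ)) ρ ×ˢ {(0 : EuclideanSpace ℝ (Fin dV))} ⊆ W)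
    (hJ00 : 0 < ∫ z in ball (0 : EuclideanSpace ℝ (Fin dZ)) ρ, Jd (z, 0))
    {Sst : Set (S × (PBond (F.P K) (K - J) → Matrix.specialUnitaryGroup (Fin 2) ℂ))}
    (hstab : ∀ k, act k (σ 0) = σ 0 → k ∈ Sst) (hfix : ∀ s ∈ Sst, ∀ y, act s (σ y) = σ y)
    (hO0 : c.Φ (V, σ 0) ∈ Sf) (hmin : wilsonAction4 (c.Φ (V, σ 0)) = m) (ha0 : 0 < (c.jac (V, σ 0) : ℝ))
    {g : GaugeField (F.P K) 0 (Matrix.specialUnitaryGroup (Fin 2) ℂ) → ℝ} (hg : ContinuousOn g Xc) (hg0 : ∀ z ∈ Xc, 0 ≤ g z)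
    (hgpos : ∀ z ∈ Xc, (∀ k, act k (σ 0) ≠ z) → 0 < g z)
    (hgrow : ∀ z ∈ Xc, c.Φ (V, z) ∈ Sf → m + g z ≤ wilsonAction4 (c.Φ (V, z)))
    {Ah : EuclideanSpace ℝ (Fin dV) →ₗ[ℝ] EuclideanSpace ℝ (Fin dV)} (hAs : Ah.IsSymmetric) (hpos : ∀ y, y ≠ 0 → 0 < ⟪Ah y, y⟫_ℝ)
    (hS2 : (fun y => wilsonAction4 (c.Φ (V, σ y)) - wilsonAction4 (c.Φ (V, σ 0)) - (1 / 2) * ⟪Ah y, y⟫_ℝ) =o[𝓝 0] fun y => ‖y‖ ^ 2) :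
    ∃ ℓ : ℝ, 0 < ℓ ∧
      Tendsto (fun lam : ℝ => lam ^ ((dV : ℝ) / 2) *
        (heightDensityCan F (γ / lam) hJK Sf V * Real.exp (lam * (F.scheme ℰp γ).β K * m))) atTop (𝓝 ℓ) :=
  ⟨_, laplaceLimit_of_charts_const_pos F hγ hJK c V S hS ν act hact hmul hone e σ he1 he𝓝 hσ hΘ'𝓝 hWo hinj hρ hρW hJ00 hstab hfix ha0 hAs hpos,
    laplaceLimit_of_charts_tendsto_local F hγ hJK hSf hO c hV m S hS ν act hact hmul hone hpres hXc hXinv hvan hA ha hAinv hainv hOrel hOinv e σ he he1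
      he𝓝 hσ hσX hΘ'𝓝 hWo hinj hJc hJ0 hchart hρ hρW hstab hfix hO0 hmin hg hg0 hgpos hgrow hAs hpos hS2⟩

end Summit.QuantumFields.YangMills.Theorems.FluctuationComparisonRegPrIntLS2BetaLaplaceInstLocal

end
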